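import Summits.NavierStokesRegularity.NavierStokesRegularity.Theses.PumpContinuation
import Summits.NavierStokesRegularity.NavierStokesRegularity.Theorems.BoundedTemperatureClosed.Negative.IsSymmetricDecoration
import Literature.Analysis.FluidPDE.TaoAveragedSobolevProofs
import Literature.Analysis.FluidPDE.TaoCascadeProjection
import Literature.Analysis.FluidPDE.TaoCascadeWaveletData

/-!
# Crux `EulerProximatePump` (stmt-NavierStokesRegularity-18302), negative side:
# what a disproof must prove, the cold sector, and the decorative clauses

Negative-side support lemmas of the crux disprover (cdisprove, cycle 1, 2026-08-17; the first two
blocks restate, as landed theorems, findings of the refuter crux-attack work file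
`Cruxes/EulerProximatePump/Disproof.lean`). Nothing here closes the item (`--supports`); no statement
of the route is changed; no conclusion asserts a Theses decl positively.

The crux ("the Door") reads, through the notation `tIB[T, M]` (Schwartz-data `H¹⁰_df`-mild Type-I
blow-up of the form `T` at ceiling `M` with no mild extension — verbatim the matrix of both cruxes of
route PumpContinuation) and `seg[𝒜, θ]` (the segment form `(1-θ)B̃_𝒜 + θB`):
`∃ 𝒜 sym canc, ∃ M, ∀ δ > 0, ∃ θ ∈ (1-δ,1) ∩ [0,∞), tIB[seg[𝒜, θ], M]` (`eulerProximatePump_iff`).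

* `not_nsTypeIBlowup_of_not_eulerProximatePump` — **the obstruction to every disproof**: at the Euler
  datum (`mᵢ ≡ 1`) the segment collapses, `seg[euler, θ] = B` for every `θ` (`seg_euler`), so any proof
  of `¬ EulerProximatePump` is a proof of Type-I blow-up EXCLUSION for the true Navier–Stokes form from
  Schwartz data at every ceiling (`∀ M, ¬ tIB[B, M]`; spelled out as an extension statement in
  `extends_of_not_eulerProximatePump`) — open (known under axisymmetry only, KNSS 2009).
* `ceiling_pos_of_tIB`, `eulerProximatePump_ceiling_pos`, `not_doorShape_of_nonpos` — **the cold
  sector `M ≤ 0` is empty** for every form killing the zero field (all segment forms do,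
  `seg_zero_left`): the Type-I bound forces `u ≡ 0`, hence `u₀ ⊥ H¹⁰_df`, hence the zero curve is a
  mild extension. So `∃ M` in the crux is effectively `∃ M > 0` (tightness of the constant's range).
* `tIB_mono` — ceilings may be enlarged.
* `eulerProximatePump_iff_noSymm` — hypothesis mutation: `𝒜.IsSymmetric` is DECORATION (the mild
  identity only evaluates the diagonal `T(u,u)`; symmetrise, Tao 2016 Remark 1.6).
* `eulerProximatePump_iff_noNonneg` — the clause `0 ≤ θ` is DECORATION (take `δ ∧ 1`).
* `doorWithoutNonExtension_trivial` — the non-extension clause is THE load-bearing conjunct: with it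
  dropped, the crux is inhabited by the zero flow (datum `0`, `u ≡ 0`, ceiling `M = 0`, any `θ`).

## References

* T. Tao, J. Amer. Math. Soc. 29 (2016), arXiv:1402.0290v3, §1.1 (1.5), (1.13), (1.15), Remark 1.6.
  [`Tao2016AveragedNS`]
* G. Koch, N. Nadirashvili, G. Seregin, V. Šverák, Acta Math. 203 (2009), arXiv:0709.3599, Thm. 5.2–5.3
  (Type-I exclusion under axisymmetry). [`KochNadirashviliSereginSverak2009`]
-/

noncomputable section

-- the nested summit namespace `…NavierStokesRegularity.NavierStokesRegularity…` is the tree's layout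
-- (D-0017), so the duplicated-namespace linter must be silenced for every declaration below
set_option linter.dupNamespace false

namespace Summit.NavierStokesRegularity.NavierStokesRegularity.Theorems.EulerProximatePump.Negative

open MeasureTheory Set Filter Topology
open scoped ENNReal SchwartzMap
open Literature.Analysis.FluidPDE Literature.Analysis.FluidPDE.Tao2016
open Summit.NavierStokesRegularity.NavierStokesRegularity.Theses.PumpContinuation
open Summit.NavierStokesRegularity.NavierStokesRegularity.Theorems.BoundedTemperatureClosed.Negative
  (isMildSolutionFor_congr_diag segForm_symmetrize_diag)

/-- Schwartz-data `H¹⁰_df`-mild Type-I blow-up of the form `T` at ceiling `M` with no mild extension —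
verbatim the matrix of the crux (a notation, so that the statements below are syntactically instances
of the crux body). -/
local notation3 "tIB[" T ", " M "]" =>
  ∃ u₀ : SchwartzMap (EuclideanSpace ℝ (Fin 3)) (EuclideanSpace ℝ (Fin 3)),
    Literature.Analysis.FluidPDE.VectorCalculus.IsDivFree ⇑u₀ ∧ ∃ S : ℝ, 0 < S ∧
    ∃ u : ℝ → Literature.Analysis.FluidPDE.Tao2016.L2C,
      Literature.Analysis.FluidPDE.Tao2016.IsMildSolutionFor T
        (Literature.Analysis.FluidPDE.Tao2016.schwartzL2 u₀) (Set.Ico 0 S) u ∧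
      (∀ t ∈ Set.Ico 0 S, MeasureTheory.eLpNorm (u t) ⊤ MeasureTheory.volume ≤
        ENNReal.ofReal (M / Real.sqrt (S - t))) ∧
      ¬ ∃ S' : ℝ, S < S' ∧ ∃ v : ℝ → Literature.Analysis.FluidPDE.Tao2016.L2C,
        Literature.Analysis.FluidPDE.Tao2016.IsMildSolutionFor T
          (Literature.Analysis.FluidPDE.Tao2016.schwartzL2 u₀) (Set.Ico 0 S') v ∧
        ∀ t ∈ Set.Ico 0 S, v t = u t

/-- The segment form `T_θ = (1-θ)·B̃_𝒜 + θ·B` of route PumpContinuation (verbatim). -/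
local notation3 "seg[" 𝒜 ", " θ "]" =>
  fun (a b c : Literature.Analysis.FluidPDE.Tao2016.L2C) =>
    ((1 - θ : ℝ) : ℂ) * AveragingDatum.form 𝒜 a b c +
      ((θ : ℝ) : ℂ) * Literature.Analysis.FluidPDE.Tao2016.eulerForm a b c

/-- The crux, read through the notation (definitional unfolding). [folklore] -/
theorem eulerProximatePump_iff :
    EulerProximatePump ↔
      ∃ 𝒜 : AveragingDatum, 𝒜.IsSymmetric ∧ 𝒜.HasCancellation ∧ ∃ M : ℝ, ∀ δ : ℝ, 0 < δ →
        ∃ θ : ℝ, 1 - δ < θ ∧ θ < 1 ∧ 0 ≤ θ ∧ tIB[seg[𝒜, θ], M] :=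
  Iff.rfl

/-! ### The obstruction: a disproof is Type-I exclusion for Navier–Stokes -/

/-- **The segment collapses at the Euler datum** (`mᵢ ≡ 1`, `Rᵢ = id`, `λᵢ = 1`, `B̃ = B`):
`T_θ = (1-θ)B + θB = B` for every `θ`. [folklore] -/
theorem seg_euler (θ : ℝ) : seg[AveragingDatum.euler, θ] = eulerForm := by
  funext a b c
  simp only [AveragingDatum.euler_form]
  push_cast
  ring

/-- **Every refutation of the Door proves Type-I exclusion for Navier–Stokes** (Schwartz data,
`H¹⁰_df`-mild, `‖u t‖_∞ ≤ M (S-t)^{-1/2}`, no mild extension), at EVERY ceiling `M`: otherwise the Euler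
datum (symmetric and cancelling) and `θ := max (1 - δ/2) 0` inhabit the crux. Type-I exclusion for
Navier–Stokes is open (settled only under axisymmetry, KNSS 2009), so no unconditional disproof of the
crux is available short of that theorem. [folklore] -/
theorem not_nsTypeIBlowup_of_not_eulerProximatePump (h : ¬ EulerProximatePump) (M : ℝ) :
    ¬ tIB[eulerForm, M] := by
  intro hM
  refine h ⟨AveragingDatum.euler, AveragingDatum.euler_isSymmetric,
    AveragingDatum.euler_hasCancellation, M, fun δ hδ => ?_⟩
  refine ⟨max (1 - δ / 2) 0, lt_of_lt_of_le (by linarith) (le_max_left _ _),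
    max_lt (by linarith) one_pos, le_max_right _ _, ?_⟩
  rw [seg_euler]
  exact hM

/-- The same obstruction, spelled out: a disproof of the crux EXTENDS every Schwartz-data
`H¹⁰_df`-mild Navier–Stokes solution obeying a Type-I bound on `[0,S)` past `S`. [folklore] -/
theorem extends_of_not_eulerProximatePump (h : ¬ EulerProximatePump) (M : ℝ)
    (u₀ : 𝓢(EuclideanSpace ℝ (Fin 3), EuclideanSpace ℝ (Fin 3))) (hdiv : VectorCalculus.IsDivFree ⇑u₀)
    (S : ℝ) (hS : 0 < S) (u : ℝ → L2C) (hu : IsMildSolutionFor eulerForm (schwartzL2 u₀) (Ico 0 S) u)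
    (hrate : ∀ t ∈ Ico 0 S, eLpNorm (u t) ⊤ volume ≤ ENNReal.ofReal (M / Real.sqrt (S - t))) :
    ∃ S' : ℝ, S < S' ∧ ∃ v : ℝ → L2C,
      IsMildSolutionFor eulerForm (schwartzL2 u₀) (Ico 0 S') v ∧ ∀ t ∈ Ico 0 S, v t = u t := by
  by_contra hno
  exact not_nsTypeIBlowup_of_not_eulerProximatePump h M ⟨u₀, hdiv, S, hS, u, hu, hrate, hno⟩

/-! ### The cold sector `M ≤ 0` is empty; ceilings may be enlarged -/

/-- Every segment form kills the zero field in its first slot. [folklore] -/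
theorem seg_zero_left (𝒜 : AveragingDatum) (θ : ℝ) (v w : L2C) : (seg[𝒜, θ]) 0 v w = 0 := by
  simp [AveragingDatum.form_zero_left, eulerForm_zero_left]

/-- **No bounded-temperature blow-up at ceiling `M ≤ 0`**, for any form `T` with `T(0,·,·) = 0`: the
Type-I bound forces `u(t) = 0` in `L²` on `[0,S)`, the mild identity at `t = 0` gives `⟨u₀, w⟩ = 0` for
all `w ∈ H¹⁰_df`, so `⟨e^{tΔ}u₀, w⟩ = ⟨u₀, e^{tΔ}w⟩ = 0` for all `t`, and `v ≡ 0` is a mild solution on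
`[0,S+1)` extending `u` — contradicting non-extension. [folklore] -/
theorem ceiling_pos_of_tIB {T : L2C → L2C → L2C → ℂ} (hT : ∀ v w, T 0 v w = 0) {M : ℝ}
    (h : tIB[T, M]) : 0 < M := by
  by_contra hM
  push Not at hM
  obtain ⟨u₀, -, S, hS, u, hu, hrate, hno⟩ := h
  have hzero : ∀ t ∈ Ico 0 S, u t = 0 := by
    intro t ht
    have h0 : ENNReal.ofReal (M / Real.sqrt (S - t)) = 0 :=
      ENNReal.ofReal_eq_zero.2 (div_nonpos_of_nonpos_of_nonneg hM (Real.sqrt_nonneg _))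
    have h1 : eLpNorm (u t) ⊤ volume = 0 := nonpos_iff_eq_zero.1 (h0 ▸ hrate t ht)
    rw [eLpNorm_eq_zero_iff (Lp.aestronglyMeasurable (u t)) ENNReal.top_ne_zero] at h1
    exact Lp.eq_zero_iff_ae_eq_zero.2 h1
  have horth : ∀ w, MemH10df w → pairing (schwartzL2 u₀) w = 0 := by
    intro w hw
    have h := hu.2.2 0 ⟨le_rfl, hS⟩ w hw
    rw [hzero 0 ⟨le_rfl, hS⟩, intervalIntegral.integral_same, add_zero, heat_zero,
      pairing_zero_left] at h
    exact h.symm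
  refine hno ⟨S + 1, by linarith, fun _ => 0, ⟨fun _ _ => memH10df_zero, continuousInH10On_zero _,
    fun t _ w hw => ?_⟩, fun t ht => (hzero t ht).symm⟩
  simp only [hT, intervalIntegral.integral_zero, add_zero, pairing_zero_left]
  rw [pairing_heat_left]
  exact (horth _ (hw.heat t)).symm

/-- **Every Door witness is hot**: a datum `𝒜` and a ceiling `M` inhabiting the crux's shape have
`0 < M`. [folklore] -/
theorem eulerProximatePump_ceiling_pos {𝒜 : AveragingDatum} {M : ℝ}
    (h : ∀ δ : ℝ, 0 < δ → ∃ θ : ℝ, 1 - δ < θ ∧ θ < 1 ∧ 0 ≤ θ ∧ tIB[seg[𝒜, θ], M]) : 0 < M := by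
  obtain ⟨θ, -, -, -, hθ⟩ := h 1 one_pos
  exact ceiling_pos_of_tIB (seg_zero_left 𝒜 θ) hθ

/-- Equivalently (degenerate-constant probe): no datum inhabits the crux's shape at a ceiling `M ≤ 0`. [folklore] -/
theorem not_doorShape_of_nonpos (𝒜 : AveragingDatum) {M : ℝ} (hM : M ≤ 0) :
    ¬ ∀ δ : ℝ, 0 < δ → ∃ θ : ℝ, 1 - δ < θ ∧ θ < 1 ∧ 0 ≤ θ ∧ tIB[seg[𝒜, θ], M] :=
  fun h => (eulerProximatePump_ceiling_pos h).not_ge hM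

/-- **Ceilings may be enlarged**: `tIB[T, M] → tIB[T, M']` for `M ≤ M'`. [folklore] -/
theorem tIB_mono {T : L2C → L2C → L2C → ℂ} {M M' : ℝ} (hMM' : M ≤ M') (h : tIB[T, M]) : tIB[T, M'] := by
  obtain ⟨u₀, hdiv, S, hS, u, hu, hrate, hno⟩ := h
  refine ⟨u₀, hdiv, S, hS, u, hu, fun t ht => (hrate t ht).trans ?_, hno⟩
  exact ENNReal.ofReal_le_ofReal (div_le_div_of_nonneg_right hMM' (Real.sqrt_nonneg _))

/-! ### Decorative clauses: `IsSymmetric` and `0 ≤ θ` -/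

/-- The blow-up predicate of `𝒜.symmetrize` along the segment is that of `𝒜` (the mild identity only
sees the diagonal, `symmetrize_form_diag`). [folklore] -/
theorem tIB_seg_symmetrize_iff (𝒜 : AveragingDatum) (θ M : ℝ) :
    tIB[seg[𝒜.symmetrize, θ], M] ↔ tIB[seg[𝒜, θ], M] := by
  simp only [isMildSolutionFor_congr_diag
    (T := fun a b c => ((1 - θ : ℝ) : ℂ) * 𝒜.symmetrize.form a b c + ((θ : ℝ) : ℂ) * eulerForm a b c)
    (T' := fun a b c => ((1 - θ : ℝ) : ℂ) * 𝒜.form a b c + ((θ : ℝ) : ℂ) * eulerForm a b c)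
    (segForm_symmetrize_diag 𝒜 θ)]

/-- **`IsSymmetric` is decoration in `EulerProximatePump`** (hypothesis-mutation finding, proved):
the crux is equivalent to its version over ALL cancelling averaging data. A cancelling witness `𝒜` is
replaced by its symmetrisation (symmetric, `symmetrize_isSymmetric`; cancelling iff,
`symmetrize_hasCancellation_iff`; same blow-ups, `tIB_seg_symmetrize_iff`). Provers may drop symmetry
from their to-do list; disprovers gain nothing from non-symmetric data. [folklore] -/
theorem eulerProximatePump_iff_noSymm :
    EulerProximatePump ↔
      ∃ 𝒜 : AveragingDatum, 𝒜.HasCancellation ∧ ∃ M : ℝ, ∀ δ : ℝ, 0 < δ →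
        ∃ θ : ℝ, 1 - δ < θ ∧ θ < 1 ∧ 0 ≤ θ ∧ tIB[seg[𝒜, θ], M] := by
  constructor
  · rintro ⟨𝒜, -, hc, M, hM⟩
    exact ⟨𝒜, hc, M, hM⟩
  · rintro ⟨𝒜, hc, M, hM⟩
    refine ⟨𝒜.symmetrize, 𝒜.symmetrize_isSymmetric, 𝒜.symmetrize_hasCancellation_iff.2 hc, M,
      fun δ hδ => ?_⟩
    obtain ⟨θ, h1, h2, h3, hθ⟩ := hM δ hδ
    exact ⟨θ, h1, h2, h3, (tIB_seg_symmetrize_iff 𝒜 θ M).2 hθ⟩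

/-- **The clause `0 ≤ θ` is decoration**: for `δ ≤ 1` it is implied by `1 - δ < θ`, and shrinking
`δ` to `min δ 1` costs nothing. [folklore] -/
theorem eulerProximatePump_iff_noNonneg :
    EulerProximatePump ↔
      ∃ 𝒜 : AveragingDatum, 𝒜.IsSymmetric ∧ 𝒜.HasCancellation ∧ ∃ M : ℝ, ∀ δ : ℝ, 0 < δ →
        ∃ θ : ℝ, 1 - δ < θ ∧ θ < 1 ∧ tIB[seg[𝒜, θ], M] := by
  constructor
  · rintro ⟨𝒜, hs, hc, M, hM⟩
    refine ⟨𝒜, hs, hc, M, fun δ hδ => ?_⟩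
    obtain ⟨θ, h1, h2, -, hθ⟩ := hM δ hδ
    exact ⟨θ, h1, h2, hθ⟩
  · rintro ⟨𝒜, hs, hc, M, hM⟩
    refine ⟨𝒜, hs, hc, M, fun δ hδ => ?_⟩
    obtain ⟨θ, h1, h2, hθ⟩ := hM (min δ 1) (lt_min hδ one_pos)
    exact ⟨θ, lt_of_le_of_lt (by linarith [min_le_left δ 1]) h1, h2,
      by linarith [min_le_right δ 1], hθ⟩

/-! ### The non-extension clause carries the whole content -/

/-- The `L²` class of the zero Schwartz field is `0`. [folklore] -/
theorem schwartzL2_zero :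
    schwartzL2 (0 : 𝓢(EuclideanSpace ℝ (Fin 3), EuclideanSpace ℝ (Fin 3))) = 0 := by
  simpa using schwartzL2_smul 0 (0 : 𝓢(EuclideanSpace ℝ (Fin 3), EuclideanSpace ℝ (Fin 3)))

/-- The zero Schwartz field is divergence free. [folklore] -/
theorem isDivFree_schwartz_zero :
    VectorCalculus.IsDivFree ⇑(0 : 𝓢(EuclideanSpace ℝ (Fin 3), EuclideanSpace ℝ (Fin 3))) := by
  intro x
  simp [VectorCalculus.divergence, FunLike.coe_zero]

/-- **Dropping the non-extension clause makes the crux trivial** (vacuity probe, proved): datum `0`,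
the zero curve `u ≡ 0` on `[0,1)` (a mild solution of every segment form, which kill `(0,0)`), ceiling
`M = 0` and any admissible `θ` inhabit everything else — at the Euler datum, so even with `IsSymmetric`
and `HasCancellation` kept. The blow-up (non-extension) clause is the load-bearing conjunct. [folklore] -/
theorem doorWithoutNonExtension_trivial :
    ∃ 𝒜 : AveragingDatum, 𝒜.IsSymmetric ∧ 𝒜.HasCancellation ∧ ∃ M : ℝ, ∀ δ : ℝ, 0 < δ →
      ∃ θ : ℝ, 1 - δ < θ ∧ θ < 1 ∧ 0 ≤ θ ∧
        ∃ u₀ : 𝓢(EuclideanSpace ℝ (Fin 3), EuclideanSpace ℝ (Fin 3)),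
          VectorCalculus.IsDivFree ⇑u₀ ∧ ∃ S : ℝ, 0 < S ∧ ∃ u : ℝ → L2C,
            IsMildSolutionFor (seg[𝒜, θ]) (schwartzL2 u₀) (Ico 0 S) u ∧
            ∀ t ∈ Ico 0 S, eLpNorm (u t) ⊤ volume ≤ ENNReal.ofReal (M / Real.sqrt (S - t)) := by
  refine ⟨AveragingDatum.euler, AveragingDatum.euler_isSymmetric,
    AveragingDatum.euler_hasCancellation, 0, fun δ hδ => ?_⟩
  refine ⟨max (1 - δ / 2) 0, lt_of_lt_of_le (by linarith) (le_max_left _ _),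
    max_lt (by linarith) one_pos, le_max_right _ _, 0, isDivFree_schwartz_zero, 1, one_pos,
    fun _ => 0, ?_, fun t _ => ?_⟩
  · rw [schwartzL2_zero]
    exact isMildSolutionFor_zero (fun w => seg_zero_left AveragingDatum.euler _ 0 w) _
  · have h0 : eLpNorm ((0 : L2C) : EuclideanSpace ℝ (Fin 3) → EuclideanSpace ℂ (Fin 3)) ⊤ volume = 0 := by
      rw [eLpNorm_congr_ae (Lp.coeFn_zero _ _ _), eLpNorm_zero]
    rw [h0]
    exact zero_le

end Summit.NavierStokesRegularity.NavierStokesRegularity.Theorems.EulerProximatePump.Negative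

end
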